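import Summits.NavierStokesRegularity.NavierStokesRegularity.Theses.HardyPointSink
import Summits.NavierStokesRegularity.NavierStokesRegularity.Theorems.LiouvilleConjectureNS
import Literature.Analysis.FluidPDE.LocalTypeILiouville
import Literature.Analysis.FluidPDE.AncientL3BackwardLiouville
import Summits.NavierStokesRegularity.NavierStokesRegularity.Theorems.HardyPointSinkNoHardyTypeIAncientWeakL3Liouville

/-!
# Route HardyPointSink — crux `NoHardyTypeIAncient` (stmt-NavierStokesRegularity-7980), line `birth`:
# the status of the line's heart, and the conditional closures of the crux

Summit-side proof file (helpers of the registered skeleton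
`Cruxes/NoHardyTypeIAncient/Lines/birth.lean`, lead c3). Three kernel-checked facts about the
crux `HardyPointSink.NoHardyTypeIAncient` ("no Hardy-bounded Type-I bounded ancient mild solution"):

* `hardyPointSink_hardyEnvelope_of_noHardyTypeIAncient` — the crux implies the statement of the
  line's load-bearing stub `stub_hardyEnvelope` (weak-`L³` bound along a backward sequence of
  times): under the crux every triple of the class is a.e. zero on the slab, so a.e. slice
  vanishes a.e. and its weak-`L³` functional is `0` along good times `τ_k → −∞`. Together with
  the skeleton's composition (envelope + Albritton–Barker 2019 Thm 4.1 ⇒ crux, whose Liouville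
  half is the landed `stub_hardyWeakL3LiouvilleOfAB41`) this gives
  `hardyPointSink_noHardyTypeIAncient_iff_hardyEnvelope`: **modulo the named fact
  `AlbrittonBarker2019_liouville_weakL3_backward` the envelope stub is EQUIVALENT to the crux** —
  line `birth` isolates nothing strictly below the crux.
* `hardyPointSink_noHardyTypeIAncient_of_liouvilleConjectureNS` — the crux follows in one line
  from the KNSS Liouville conjecture (L) (canonical conjecture leaf
  `Summit.NavierStokesRegularity.NavierStokesRegularity.LiouvilleConjectureNS`), through
  `LiouvilleConjectureNS.not_nontrivialMildAncientTypeIExists_measurable`.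
* `hardyPointSink_noHardyTypeIAncient_of_not_typeIAncient_measurable` /
  `…_of_not_nontrivialMildAncientTypeIExists` — and, more cheaply, from the Type-I Liouville
  statement (L′) (no non-trivial Type-I bounded ancient mild solution, with or without the
  slice-measurability clause): the crux is (L′) weakened by the Hardy hypothesis.

## References

* D. Albritton, T. Barker, J. Math. Fluid Mech. 21 (2019) no. 43 = arXiv:1811.00502, §1, Thm 4.1.
* G. Koch, N. Nadirashvili, G. Seregin, V. Šverák, Acta Math. 203 (2009), §1.
-/

noncomputable section

set_option linter.dupNamespace false

open MeasureTheory Set Function Filter TopologicalSpace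
open scoped ENNReal NNReal Topology

namespace Summit.NavierStokesRegularity.NavierStokesRegularity.Theorems

open Summit.NavierStokesRegularity.NavierStokesRegularity.Theses.HardyPointSink

/-! ### Measure-theoretic helpers -/

/-- **A.e. statements on `(−∞, 0)` hold along a sequence tending to `−∞`**: a full-measure subset
of `Iio 0` meets every interval `(−(n+2), −(n+1))`. [folklore] -/
theorem hardyPointSink_exists_seq_tendsto_atBot_of_ae_Iio {P : ℝ → Prop}
    (h : ∀ᵐ s ∂(volume.restrict (Iio (0 : ℝ))), P s) :
    ∃ s : ℕ → ℝ, (∀ n, P (s n)) ∧ (∀ n, s n < 0) ∧ Tendsto s atTop atBot := by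
  have key : ∀ n : ℕ, ∃ s ∈ Ioo (-((n : ℝ) + 2)) (-((n : ℝ) + 1)), P s := by
    intro n
    by_contra hcon
    simp only [not_exists, not_and] at hcon
    have hsub : Ioo (-((n : ℝ) + 2)) (-((n : ℝ) + 1)) ⊆ {s | ¬ (s ∈ Iio (0 : ℝ) → P s)} := by
      intro s hs himp
      have hs0 : s ∈ Iio (0 : ℝ) := by
        show s < 0
        have := hs.2
        linarith
      exact hcon s hs (himp hs0)
    have hzero : volume {s | ¬ (s ∈ Iio (0 : ℝ) → P s)} = 0 := by
      have := (ae_restrict_iff' (measurableSet_Iio (a := (0 : ℝ)))).1 h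
      exact ae_iff.1 this
    have hpos : 0 < volume (Ioo (-((n : ℝ) + 2)) (-((n : ℝ) + 1))) := by
      rw [Real.volume_Ioo]
      simp
    have := measure_mono (μ := volume) hsub
    rw [hzero] at this
    exact absurd this (not_le.2 hpos)
  choose s hs hP using key
  refine ⟨s, hP, fun n => ?_, ?_⟩
  · have := (hs n).2
    have hn : (0 : ℝ) ≤ n := Nat.cast_nonneg n
    linarith
  · refine tendsto_atBot.2 fun b => ?_
    obtain ⟨N, hN⟩ := exists_nat_gt (-b)
    refine Filter.eventually_atTop.2 ⟨N, fun n hn => ?_⟩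
    have h1 := (hs n).2
    have h2 : (N : ℝ) ≤ n := Nat.cast_le.2 hn
    linarith

/-- **A field a.e. zero on the slab `(−∞, 0) × ℝ³` has a.e. slice a.e. zero** (Fubini–Tonelli for
null sets: the slab measure is the product of the restricted measures, then
`Measure.ae_ae_of_ae_prod`). [folklore] -/
theorem hardyPointSink_ae_slice_zero_of_ae_eq_zero_slab
    {u : ℝ → EuclideanSpace ℝ (Fin 3) → EuclideanSpace ℝ (Fin 3)}
    (hae : uncurry u =ᵐ[volume.restrict
      (Iio (0 : ℝ) ×ˢ (univ : Set (EuclideanSpace ℝ (Fin 3))))] 0) :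
    ∀ᵐ t ∂(volume.restrict (Iio (0 : ℝ))), u t =ᵐ[volume] 0 := by
  have hprod : (volume.restrict (Iio (0 : ℝ) ×ˢ (univ : Set (EuclideanSpace ℝ (Fin 3)))) :
      Measure (ℝ × EuclideanSpace ℝ (Fin 3))) =
      ((volume : Measure ℝ).restrict (Iio 0)).prod
        ((volume : Measure (EuclideanSpace ℝ (Fin 3))).restrict univ) := by
    rw [Measure.prod_restrict, ← Measure.volume_eq_prod]
  rw [hprod] at hae
  have h2 := Measure.ae_ae_of_ae_prod hae
  rw [Measure.restrict_univ] at h2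
  filter_upwards [h2] with t ht
  filter_upwards [ht] with x hx
  simpa [uncurry] using hx

/-- **An a.e.-zero slice has zero weak-`L³` functional**: `vol{s < |f|} = 0` for `s > 0` when
`f = 0` a.e. [folklore] -/
theorem hardyPointSink_volume_superlevel_eq_zero_of_ae_eq_zero
    {f : EuclideanSpace ℝ (Fin 3) → EuclideanSpace ℝ (Fin 3)} (hf : f =ᵐ[volume] 0)
    {s : ℝ} (hs : 0 < s) :
    volume {x : EuclideanSpace ℝ (Fin 3) | s < ‖f x‖} = 0 := by
  rw [measure_eq_zero_iff_ae_notMem]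
  filter_upwards [hf] with x hx
  simp only [not_lt, hx, Pi.zero_apply, norm_zero]
  exact hs.le

/-! ### The crux implies the envelope: the heart of line `birth` is the crux itself -/

/-- **The crux implies the statement of the load-bearing stub `stub_hardyEnvelope` of line
`birth`.** If `HardyPointSink.NoHardyTypeIAncient` holds then every triple `(u, p, G)` of its
class (measurable slices, bounded ancient mild solution with `ν = 1`, suitable weak on the slab,
weak spatial gradient, `𝐈(ℝ³ × ℝ₋) < ∞`, Hardy bound about every centre at a.e. time) admits
negative times `τ_k → −∞` and `M < ∞` with `s³ · vol{s < |u(τ_k)|} ≤ M` for all `s > 0` — indeed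
with `M = 0`: such a triple is a.e. zero on the slab (otherwise it is a witness against the crux),
so a.e. slice is a.e. zero, and good times accumulate at `−∞`. [folklore] -/
theorem hardyPointSink_hardyEnvelope_of_noHardyTypeIAncient (hN : NoHardyTypeIAncient) :
    ∀ (u : ℝ → EuclideanSpace ℝ (Fin 3) → EuclideanSpace ℝ (Fin 3))
      (p : ℝ → EuclideanSpace ℝ (Fin 3) → ℝ)
      (G : ℝ → EuclideanSpace ℝ (Fin 3) → EuclideanSpace ℝ (Fin 3) →L[ℝ] EuclideanSpace ℝ (Fin 3)),
      (∀ t < 0, AEStronglyMeasurable (u t) volume) →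
      Literature.Analysis.FluidPDE.IsBoundedAncientMildSolution 1 u →
      Literature.Analysis.FluidPDE.IsSuitableWeakSolutionOn
        (Literature.Analysis.FluidPDE.slab (EuclideanSpace ℝ (Fin 3)) (Iio 0) isOpen_Iio) 1 0 u p →
      Literature.Analysis.FluidPDE.HasWeakSpatialGradientOn
        (Literature.Analysis.FluidPDE.slab (EuclideanSpace ℝ (Fin 3)) (Iio 0) isOpen_Iio) u G →
      Literature.Analysis.FluidPDE.typeIBound
        (Iio (0 : ℝ) ×ˢ (univ : Set (EuclideanSpace ℝ (Fin 3)))) u p G < ⊤ →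
      (∃ K : ℝ≥0, ∀ x₀ : EuclideanSpace ℝ (Fin 3), ∀ᵐ t ∂(volume.restrict (Iio (0 : ℝ))),
        ∫⁻ x, ‖u t x‖ₑ ^ 2 / ‖x - x₀‖ₑ ≤ K) →
      ∃ (τ : ℕ → ℝ) (M : ℝ≥0∞), M < ⊤ ∧ Tendsto τ atTop atBot ∧ (∀ k, τ k < 0) ∧
        ∀ (k : ℕ) (s : ℝ), 0 < s →
          ENNReal.ofReal s ^ 3 * volume {x : EuclideanSpace ℝ (Fin 3) | s < ‖u (τ k) x‖} ≤ M := by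
  intro u p G hmeas hu hsw hG hI hH
  -- `u` is a.e. zero on the slab, else `(u, p, G)` refutes the crux
  have hae : uncurry u =ᵐ[volume.restrict
      (Iio (0 : ℝ) ×ˢ (univ : Set (EuclideanSpace ℝ (Fin 3))))] 0 := by
    by_contra hne
    exact hN ⟨u, p, G, hmeas, hu, hsw, hG, hne, hI, hH⟩
  -- hence a.e. slice is a.e. zero; pick good times accumulating at `-∞`
  obtain ⟨τ, hτP, hτneg, hτbot⟩ := hardyPointSink_exists_seq_tendsto_atBot_of_ae_Iio
    (hardyPointSink_ae_slice_zero_of_ae_eq_zero_slab hae)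
  refine ⟨τ, 0, ENNReal.zero_lt_top, hτbot, hτneg, fun k s hs => ?_⟩
  rw [hardyPointSink_volume_superlevel_eq_zero_of_ae_eq_zero (hτP k) hs, mul_zero]

/-- **Heart ≡ crux, modulo Albritton–Barker 2019 Thm 4.1.** Under the named fact
`Literature.Analysis.FluidPDE.AlbrittonBarker2019_liouville_weakL3_backward` (A–B 2019, Thm 4.1,
`ε = 0`, Oseen class), the crux `HardyPointSink.NoHardyTypeIAncient` is EQUIVALENT to the
statement of the stub `stub_hardyEnvelope` of line `birth`: `→` is
`hardyPointSink_hardyEnvelope_of_noHardyTypeIAncient` (unconditional); `←` is the skeleton's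
composition — joint measurability from the weak gradient, the envelope, the landed Liouville half
`stub_hardyWeakL3LiouvilleOfAB41`, and `ae_eq_zero_slab_of_ae_slice`. So the line's only open stub
carries the whole crux. [cite: AlbrittonBarker2019, Thm 4.1 (arXiv:1811.00502 §4 p. 9)] -/
theorem hardyPointSink_noHardyTypeIAncient_iff_hardyEnvelope :
    Literature.Analysis.FluidPDE.AlbrittonBarker2019_liouville_weakL3_backward →
    (Summit.NavierStokesRegularity.NavierStokesRegularity.Theses.HardyPointSink.NoHardyTypeIAncient ↔
    ∀ (u : ℝ → EuclideanSpace ℝ (Fin 3) → EuclideanSpace ℝ (Fin 3))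
      (p : ℝ → EuclideanSpace ℝ (Fin 3) → ℝ)
      (G : ℝ → EuclideanSpace ℝ (Fin 3) → EuclideanSpace ℝ (Fin 3) →L[ℝ] EuclideanSpace ℝ (Fin 3)),
      (∀ t < 0, AEStronglyMeasurable (u t) volume) →
      Literature.Analysis.FluidPDE.IsBoundedAncientMildSolution 1 u →
      Literature.Analysis.FluidPDE.IsSuitableWeakSolutionOn
        (Literature.Analysis.FluidPDE.slab (EuclideanSpace ℝ (Fin 3)) (Iio 0) isOpen_Iio) 1 0 u p →
      Literature.Analysis.FluidPDE.HasWeakSpatialGradientOn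
        (Literature.Analysis.FluidPDE.slab (EuclideanSpace ℝ (Fin 3)) (Iio 0) isOpen_Iio) u G →
      Literature.Analysis.FluidPDE.typeIBound
        (Iio (0 : ℝ) ×ˢ (univ : Set (EuclideanSpace ℝ (Fin 3)))) u p G < ⊤ →
      (∃ K : ℝ≥0, ∀ x₀ : EuclideanSpace ℝ (Fin 3), ∀ᵐ t ∂(volume.restrict (Iio (0 : ℝ))),
        ∫⁻ x, ‖u t x‖ₑ ^ 2 / ‖x - x₀‖ₑ ≤ K) →
      ∃ (τ : ℕ → ℝ) (M : ℝ≥0∞), M < ⊤ ∧ Tendsto τ atTop atBot ∧ (∀ k, τ k < 0) ∧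
        ∀ (k : ℕ) (s : ℝ), 0 < s →
          ENNReal.ofReal s ^ 3 * volume {x : EuclideanSpace ℝ (Fin 3) | s < ‖u (τ k) x‖} ≤ M) := by
  intro hF
  refine ⟨hardyPointSink_hardyEnvelope_of_noHardyTypeIAncient, fun hEnv => ?_⟩
  rintro ⟨u, p, G, hmeas, hu, hsw, hG, hne, hI, hH⟩
  -- joint measurability on the slab, from the weak spatial gradient
  have hjoint : AEStronglyMeasurable (uncurry u)
      (volume.restrict (Iio (0 : ℝ) ×ˢ (univ : Set (EuclideanSpace ℝ (Fin 3))))) :=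
    hG.locallyIntegrableOn.aestronglyMeasurable
  -- the envelope, then the landed Liouville half (conditional on the fact)
  have hE := hEnv u p G hmeas hu hsw hG hI hH
  have hslice : ∀ᵐ t ∂(volume.restrict (Iio (0 : ℝ))), u t =ᵐ[volume] 0 :=
    stub_hardyWeakL3LiouvilleOfAB41 hF u hmeas hjoint hu hH hE
  refine hne ?_
  filter_upwards [Literature.Analysis.FluidPDE.ae_eq_zero_slab_of_ae_slice hjoint hslice] with z hz
  exact hz

/-! ### Conditional closures of the crux from the catalogued Liouville statements -/

/-- **The crux from the Type-I Liouville statement (L′), measurable-slice form.** If there is no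
triple `(u, p, G)` with measurable slices, `u` a bounded ancient mild solution (`ν = 1`), suitable
weak on the slab with pressure `p`, weak spatial gradient `G`, `u` not a.e. zero, and
`𝐈(ℝ³ × ℝ₋) < ∞` (the statement refuted by (L) in
`LiouvilleConjectureNS.not_nontrivialMildAncientTypeIExists_measurable`), then a fortiori there is
no such triple which is moreover Hardy-bounded: `HardyPointSink.NoHardyTypeIAncient`.
[cite: AlbrittonBarker2019, §1 after Thm 1.1] -/
theorem hardyPointSink_noHardyTypeIAncient_of_not_typeIAncient_measurable
    (h : ¬ ∃ (u : ℝ → EuclideanSpace ℝ (Fin 3) → EuclideanSpace ℝ (Fin 3))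
        (p : ℝ → EuclideanSpace ℝ (Fin 3) → ℝ)
        (G : ℝ → EuclideanSpace ℝ (Fin 3) → EuclideanSpace ℝ (Fin 3) →L[ℝ] EuclideanSpace ℝ (Fin 3)),
      (∀ t < 0, AEStronglyMeasurable (u t) volume) ∧
      Literature.Analysis.FluidPDE.IsBoundedAncientMildSolution 1 u ∧
      Literature.Analysis.FluidPDE.IsSuitableWeakSolutionOn
        (Literature.Analysis.FluidPDE.slab (EuclideanSpace ℝ (Fin 3)) (Iio 0) isOpen_Iio) 1 0 u p ∧
      Literature.Analysis.FluidPDE.HasWeakSpatialGradientOn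
        (Literature.Analysis.FluidPDE.slab (EuclideanSpace ℝ (Fin 3)) (Iio 0) isOpen_Iio) u G ∧
      ¬ (uncurry u =ᵐ[volume.restrict
        (Iio (0 : ℝ) ×ˢ (univ : Set (EuclideanSpace ℝ (Fin 3))))] 0) ∧
      Literature.Analysis.FluidPDE.typeIBound
        (Iio (0 : ℝ) ×ˢ (univ : Set (EuclideanSpace ℝ (Fin 3)))) u p G < ⊤) :
    NoHardyTypeIAncient := by
  rintro ⟨u, p, G, hmeas, hu, hsw, hG, hne, hI, -⟩
  exact h ⟨u, p, G, hmeas, hu, hsw, hG, hne, hI⟩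

/-- **The crux from `¬ NontrivialMildAncientTypeIExists`** (the right-hand side of Albritton–Barker's
Thm 1.1 characterization, registered open statement of `LocalTypeI.lean`): dropping the
measurability clause only strengthens the hypothesis. [cite: AlbrittonBarker2019, Thm 1.1] -/
theorem hardyPointSink_noHardyTypeIAncient_of_not_nontrivialMildAncientTypeIExists
    (h : ¬ Literature.Analysis.FluidPDE.NontrivialMildAncientTypeIExists) :
    NoHardyTypeIAncient := by
  refine hardyPointSink_noHardyTypeIAncient_of_not_typeIAncient_measurable ?_
  rintro ⟨u, p, G, -, hu, hsw, hG, hne, hI⟩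
  exact h ⟨u, p, G, hu, hsw, hG, hne, hI⟩

/-- **The crux from the KNSS Liouville conjecture (L).** Under the canonical conjecture leaf
`Summit.NavierStokesRegularity.NavierStokesRegularity.LiouvilleConjectureNS` (every bounded ancient
mild solution with measurable slices is slice-wise a.e. constant; KNSS 2009 §1), the crux
`HardyPointSink.NoHardyTypeIAncient` holds: (L) refutes every Type-I bounded ancient witness with
measurable slices (`LiouvilleConjectureNS.not_nontrivialMildAncientTypeIExists_measurable`:
constant slices have `𝐈 = ∞` unless zero), Hardy-bounded or not. This is the one-line closure
"from KNSS (L)" recorded in the item's informal statement; it makes the crux CONDITIONAL on an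
open conjecture and credits nothing. [cite: KochNadirashviliSereginSverak2009, §1] -/
theorem hardyPointSink_noHardyTypeIAncient_of_liouvilleConjectureNS :
    Summit.NavierStokesRegularity.NavierStokesRegularity.LiouvilleConjectureNS →
    Summit.NavierStokesRegularity.NavierStokesRegularity.Theses.HardyPointSink.NoHardyTypeIAncient := by
  intro hL
  have hL' : Literature.Analysis.FluidPDE.LiouvilleConjectureNS := fun u hu hm => hL u hu hm
  exact hardyPointSink_noHardyTypeIAncient_of_not_typeIAncient_measurable
    hL'.not_nontrivialMildAncientTypeIExists_measurable

end Summit.NavierStokesRegularity.NavierStokesRegularity.Theorems
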